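import Literature.AnabelianGeometry.EtaleTheta.Discharge.Sec3Cor38CriterionSlice
import Literature.AnabelianGeometry.EtaleTheta.Discharge.Sec3Cor38iiiFSM
import Literature.AlgebraicGeometry.Frobenioids.PerfectionSquareUnique
import Literature.AlgebraicGeometry.Frobenioids.PerfectionSquareFSMFF2024
import HarnessLib

/-!
# [EtTh] Corollary 3.8 (i)/(ii) sub-DAG — row C38-L03′: "`Ψ` is compatible with the operation of passing
# to the perfection", FAITHFUL re-type (structure-compatible `1`-uniqueness), PROVED

Mochizuki, *The étale theta function …*, Publ. RIMS **45** (2009), Cor. 3.8, proof PDF p.81 l.3–4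
[cite: MochizukiEtTh2009, Cor 3.8 p.81]: "Moreover, `Ψ` is compatible with the operation of passing to the
perfection [cf. [Mzk17], Theorem 3.4, (iii)]"; [Mzk17] = Mochizuki, *The geometry of Frobenioids I*, Kyushu J.
Math. **62** (2008), Thm. 3.4 (iii) p.62, printed proof p.64 ll.26–28 [cite: MochizukiFrdI2008, Thm. 3.4 (iii) p.62].

abc-iut cell, layer L2, seat abc-iut-w5-d124 (gen 3); companion of `TemperedFrobenioidCor38Sub.lean` (p414329,
DEFINITION FROZEN — not edited; table `plan/L2/SUBDAG-EtTh-Cor38.md`).  The frozen row C38-L03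
`Cor38Hyp.CompatibleWithPerfection` types "compatible with passing to the perfection" as a BARE `1`-unique
square (`OneUniqueSquare`: unique among ALL functors fitting the square) over the [FrdI] Prop. 3.2 (i)
interface `PerfectionData`; its only derivation runs from the schema `Thm34iii_pf`, refuted as typed at honest
non-perfect instances (`DegreeModel.not_thm34iii_pf`, seat abc-iut-L1-d4; ruling C38-L03 of abc-iut-L2-lead
2026-08-26T02:32Z: "typed-stronger-than-print").  Print's [FrdI] Thm. 3.4 (iii) gives uniqueness only among the
functors COMPATIBLE WITH THE FROBENIOID STRUCTURES (seat abc-iut-L1-d1, `PerfectionSquareUnique.lean`).  This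
file is the append-only repair (post-freeze rule (B)(1): new file, the frozen decl stays as the settled edge):

* `Cor38Hyp.CompatibleWithPerfectionR hF₁ hF₂` (row **C38-L03′**, faithful shape) — for THE perfections
  `C_i^pf = PreFrobenioidData.perfection hF_i` (`hF_i : IsFrobenioid C_i.toElem`, [FrdI] Thm. 5.2 (ii), the
  standing binder of rows C38-L05/L06): an EQUIVALENCE `Ψ^pf : C₁^pf ⥲ C₂^pf` with `Ψ ⋙ (C₂ → C₂^pf) ≅
  (C₁ → C₁^pf) ⋙ Ψ^pf`, unique up to isomorphism among the functors `B′ : C₁^pf → C₂^pf` that carry arrows of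
  Frobenius type to arrows of Frobenius type of the same Frobenius degree and fit into the square — PROVED in
  this file (typed case of a printed statement proved alongside; no new hypothesis enters any consumer);
* derivations, vocabulary-generic (`V`, `VD` arbitrary): `…_of_isFrobeniusCompatible` (⟸ `Ψ` compatible
  with arrows of Frobenius type, L1 `PreFrobenioid.Perfection.pfSquareR_map`; `C₂` is of Frobenius-isotropic
  type by Thm. 3.7 (i), `TemperedFrobenioid.isOfType_isFrobeniusIsotropic`), `…_of_thm34iii` (⟸ the typed
  [FrdI] Thm. 3.4 (iii) `PreFrobenioidData.Thm34iii` + C38-L01, as the frozen row; `HypB` is vacuous since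
  `C₁` is not of group-like type), and the first two conjuncts of the frozen shape (`exists_oneCommutes_of_R`);
* at the canonical monoid vocabulary `treeMonoidVocab` (the [FrdI] predicates themselves): C38-L03′ ⟸ C38-L02a
  (`…_of_preservesPreSteps`: pre-step preservation makes `Ψ` Frobenius-compatible, L1
  `FrdI.isFrobeniusCompatible_of_preservesPreSteps`, quasi-isotropic type / non-dilating / a non-group-like
  object from Thm. 3.7 (i) and `Cor38Hyp`); the sequel `Sec3Cor38PerfectionRHolds.lean` discharges C38-L02a —
  hence C38-L03′ — modulo `hF₁`, `hF₂` only, from L1's proved [FrdI] Thm. 3.4 (ii) over FSMFF-type bases.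

HONEST FRAMING: refereed pre-IUT material ([EtTh] §3 over [FrdI] §3); nothing here bears on [IUTchIII]
Cor. 3.12; no statement of either paper is strengthened; typed ≠ proved — here proved.
-/

namespace Literature.AnabelianGeometry.EtaleTheta

open CategoryTheory Opposite Literature.AlgebraicGeometry.Frobenioids

universe u₀ v₀ u v w

section General

variable {D₀ : Type u₀} [Category.{v₀} D₀] {V : FrdIMonoidStub.{w}} {T : RealifiedDivisorMonoids (D₀ := D₀) V}
  {D : Type u} [Category.{v} D] {VD : FrdICatStub.{u, v, w} D}
  {D₀' : Type u₀} [Category.{v₀} D₀'] {T' : RealifiedDivisorMonoids (D₀ := D₀') V}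
  {D' : Type u} [Category.{v} D'] {VD' : FrdICatStub.{u, v, w} D'}
  {C₁ : TemperedFrobenioid T D VD} {C₂ : TemperedFrobenioid T' D' VD'}

namespace Cor38Hyp

variable (h : Cor38Hyp C₁ C₂)

/-- **C38-L03′** (proof of Cor. 3.8, p.81 l.3–4: "Moreover, `Ψ` is compatible with the operation of passing to
the perfection [cf. [Mzk17], Theorem 3.4, (iii)]") — FAITHFUL re-type of the frozen row C38-L03, for THE
perfections `C_i^pf` ([FrdI] Def. 3.1 (iii)) of the Frobenioids `C_i → F_{Φ_i}` (`hF_i`, [FrdI] Thm. 5.2 (ii)):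
there is an equivalence `Ψ^pf : C₁^pf ⥲ C₂^pf` with `Ψ ⋙ (C₂ → C₂^pf) ≅ (C₁ → C₁^pf) ⋙ Ψ^pf`, unique up to
isomorphism among the functors compatible with the Frobenioid structures (arrows of Frobenius type to arrows of
Frobenius type of the same degree) that fit into the square — [FrdI] Thm. 3.4 (iii)'s "`1`-unique" in the
structure-compatible reading of its printed proof (p.64 ll.26–28). Proved below. [cite: MochizukiEtTh2009, Cor 3.8 p.81] -/
def CompatibleWithPerfectionR (hF₁ : PreFrobenioid.IsFrobenioid C₁.toElem)
    (hF₂ : PreFrobenioid.IsFrobenioid C₂.toElem) : Prop :=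
  ∃ Ψpf : (PreFrobenioidData.perfection hF₁).Pf ≌ (PreFrobenioidData.perfection hF₂).Pf,
    OneCommutes h.Ψ.functor (PreFrobenioidData.perfection hF₂).toPf (PreFrobenioidData.perfection hF₁).toPf
        Ψpf.functor ∧
      ∀ B' : (PreFrobenioidData.perfection hF₁).Pf ⥤ (PreFrobenioidData.perfection hF₂).Pf,
        PreFrobenioidData.PreservesMor B' (PreFrobenioidData.perfection hF₁).ops.IsFrobeniusType
            (PreFrobenioidData.perfection hF₂).ops.IsFrobeniusType →
          (∀ ⦃X Y : (PreFrobenioidData.perfection hF₁).Pf⦄ (f : X ⟶ Y),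
              (PreFrobenioidData.perfection hF₁).ops.IsFrobeniusType f →
                (PreFrobenioidData.perfection hF₂).ops.degFr (B'.map f) =
                  (PreFrobenioidData.perfection hF₁).ops.degFr f) →
            OneCommutes h.Ψ.functor (PreFrobenioidData.perfection hF₂).toPf
                (PreFrobenioidData.perfection hF₁).toPf B' →
              Nonempty (B' ≅ Ψpf.functor)

/-- C38-L03′ ⟸ "`Ψ` carries arrows of Frobenius type to arrows of Frobenius type of the same Frobenius degree"
(L1 `PreFrobenioid.IsFrobeniusCompatible`): the functor `Ψ^pf = Perfection.map` of [FrdI] Thm. 3.4 (iii) is an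
equivalence `1`-commuting with `C_i → C_i^pf`, structure-compatibly `1`-unique (L1
`PreFrobenioid.Perfection.pfSquareR_map`; `C₂` is of Frobenius-isotropic type by Thm. 3.7 (i)). PROVED.
[cite: MochizukiEtTh2009, Cor 3.8 p.81] -/
theorem compatibleWithPerfectionR_of_isFrobeniusCompatible (hF₁ : PreFrobenioid.IsFrobenioid C₁.toElem)
    (hF₂ : PreFrobenioid.IsFrobenioid C₂.toElem)
    (hΨ : PreFrobenioid.IsFrobeniusCompatible C₁.toElem C₂.toElem h.Ψ.functor) :
    h.CompatibleWithPerfectionR hF₁ hF₂ := by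
  obtain ⟨hequiv, hcomm, huniq⟩ :=
    PreFrobenioid.Perfection.pfSquareR_map (hF₁ := hF₁) (hF₂ := hF₂) (C₂.isOfType_isFrobeniusIsotropic hF₂)
      h.Ψ hΨ
  haveI := hequiv
  exact ⟨(PreFrobenioid.Perfection.map (hF₁ := hF₁) (hF₂ := hF₂) hΨ).asEquivalence, hcomm, huniq⟩

/-- Hypothesis (b) `HypB` of [FrdI] Thm. 3.4 (iii) is VACUOUS for tempered Frobenioids: by C38-L01 (Thm. 3.7 (i))
`C₁` is not of group-like type. [cite: MochizukiEtTh2009, Cor 3.8 p.81] -/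
theorem hypB_of_standardIsotropicNotGroupLike (H : h.StandardIsotropicNotGroupLike) :
    PreFrobenioidData.HypB C₁.opsData C₂.opsData h.Ψ :=
  fun hg _ => absurd hg H.notGroupLike.1

/-- … and for `Ψ⁻¹`. [cite: MochizukiEtTh2009, Cor 3.8 p.81] -/
theorem hypB_symm_of_standardIsotropicNotGroupLike (H : h.StandardIsotropicNotGroupLike) :
    PreFrobenioidData.HypB C₂.opsData C₁.opsData h.Ψ.symm :=
  fun hg _ => absurd hg H.notGroupLike.2

/-- The typed [FrdI] Thm. 3.4 (iii) (`PreFrobenioidData.Thm34iii`, morphisms-and-degrees part), with C38-L01,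
makes `Ψ` compatible with arrows of Frobenius type: Frobenius type is preserved and — `C₁`, `C₂` admitting
non-group-like objects — `Ψ^{ℕ≥1}` is the identity. PROVED. [cite: MochizukiEtTh2009, Cor 3.8 p.81] -/
theorem isFrobeniusCompatible_of_thm34iii (h12 : C₁.opsData.Thm34iii C₂.opsData h.Ψ)
    (H : h.StandardIsotropicNotGroupLike) :
    PreFrobenioid.IsFrobeniusCompatible C₁.toElem C₂.toElem h.Ψ.functor := by
  obtain ⟨⟨hfr, -⟩, ΨN, hdeg, hΨN⟩ := h12 H.standard.1 H.standard.2 (h.hypB_of_standardIsotropicNotGroupLike H)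
  have hN₁ : ∃ A : C₁.category, ¬ C₁.opsData.IsGroupLikeObj A := by
    by_contra hne
    exact H.notGroupLike.1 ⟨fun A => not_not.1 (not_exists.1 hne A)⟩
  have hN₂ : ∃ A : C₂.category, ¬ C₂.opsData.IsGroupLikeObj A := by
    by_contra hne
    exact H.notGroupLike.2 ⟨fun A => not_not.1 (not_exists.1 hne A)⟩
  have hid := hΨN hN₁ hN₂
  subst hid
  refine ⟨fun A B f hf => ?_, fun A B f _ => ?_⟩
  · exact (PreFrobenioidData.ofFunctor_isFrobeniusType C₂.toElem _).1
      (hfr f ((PreFrobenioidData.ofFunctor_isFrobeniusType C₁.toElem f).2 hf))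
  · simpa only [PreFrobenioidData.ofFunctor_degFr, MulEquiv.refl_apply] using hdeg f

/-- **C38-L03′ ⟸ [FrdI] Thm. 3.4 (iii) (typed) + C38-L01** — the derivation of the frozen row, now landing in
the faithful shape (hypothesis (b) discharged, `C_i` not of group-like type). PROVED.
[cite: MochizukiEtTh2009, Cor 3.8 p.81] -/
theorem compatibleWithPerfectionR_of_thm34iii (hF₁ : PreFrobenioid.IsFrobenioid C₁.toElem)
    (hF₂ : PreFrobenioid.IsFrobenioid C₂.toElem) (h12 : C₁.opsData.Thm34iii C₂.opsData h.Ψ)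
    (H : h.StandardIsotropicNotGroupLike) : h.CompatibleWithPerfectionR hF₁ hF₂ :=
  h.compatibleWithPerfectionR_of_isFrobeniusCompatible hF₁ hF₂ (h.isFrobeniusCompatible_of_thm34iii h12 H)

/-- C38-L03′ contains the first two conjuncts of the frozen C38-L03 at THE perfections (existence of `Ψ^pf`,
an equivalence, and `1`-commutativity of the square) — the part row C38-L06 consumes. PROVED.
[cite: MochizukiEtTh2009, Cor 3.8 p.81] -/
theorem exists_oneCommutes_of_compatibleWithPerfectionR {hF₁ : PreFrobenioid.IsFrobenioid C₁.toElem}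
    {hF₂ : PreFrobenioid.IsFrobenioid C₂.toElem} (hc : h.CompatibleWithPerfectionR hF₁ hF₂) :
    ∃ Ψpf : (PreFrobenioidData.perfection hF₁).Pf ⥤ (PreFrobenioidData.perfection hF₂).Pf,
      Ψpf.IsEquivalence ∧
        OneCommutes h.Ψ.functor (PreFrobenioidData.perfection hF₂).toPf (PreFrobenioidData.perfection hF₁).toPf
          Ψpf := by
  obtain ⟨Ψpf, hcomm, -⟩ := hc
  exact ⟨Ψpf.functor, Ψpf.isEquivalence_functor, hcomm⟩

end Cor38Hyp

end General

/-! ### At the canonical monoid vocabulary `treeMonoidVocab`: C38-L03′ ⟸ C38-L02a, and both HOLD modulo `hF` -/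

section TreeVocab

variable {D₀ : Type u₀} [Category.{v₀} D₀] {T : RealifiedDivisorMonoids (D₀ := D₀) treeMonoidVocab.{w}}
  {D : Type u} [Category.{v} D] {VD : FrdICatStub.{u, v, w} D}
  {D₀' : Type u₀} [Category.{v₀} D₀'] {T' : RealifiedDivisorMonoids (D₀ := D₀') treeMonoidVocab.{w}}
  {D' : Type u} [Category.{v} D'] {VD' : FrdICatStub.{u, v, w} D'}
  {C₁ : TemperedFrobenioid T D VD} {C₂ : TemperedFrobenioid T' D' VD'} (h : Cor38Hyp C₁ C₂)

namespace Cor38Hyp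

open TemperedFrobenioid

/-- C38-L02a ⟹ `Ψ` is compatible with arrows of Frobenius type (the content of [FrdI] Thm. 3.4 (iii) used to
form `Ψ^pf`; L1 `FrdI.isFrobeniusCompatible_of_preservesPreSteps`): `C_i` are of quasi-isotropic type and admit
non-group-like objects (Thm. 3.7 (i)), `Φ_i` are non-dilating (`Cor38Hyp`). PROVED. [cite: MochizukiEtTh2009, Cor 3.8 p.81] -/
theorem isFrobeniusCompatible_of_preservesPreSteps (hF₁ : PreFrobenioid.IsFrobenioid C₁.toElem)
    (hF₂ : PreFrobenioid.IsFrobenioid C₂.toElem) (hps : h.PreservesPreSteps) :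
    PreFrobenioid.IsFrobeniusCompatible C₁.toElem C₂.toElem h.Ψ.functor :=
  FrdI.isFrobeniusCompatible_of_preservesPreSteps hF₁ hF₂ (C₁.data_isOfQuasiIsotropicType hF₁)
    (C₂.data_isOfQuasiIsotropicType hF₂) (C₁.data_isNonDilatingOn h.nonDilating.1)
    (C₂.data_isNonDilatingOn h.nonDilating.2) h.Ψ hps.1 hps.2 C₁.exists_not_isGroupLikeObj
    C₂.exists_not_isGroupLikeObj

/-- The same for `Ψ⁻¹`. PROVED. [cite: MochizukiEtTh2009, Cor 3.8 p.81] -/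
theorem isFrobeniusCompatible_inverse_of_preservesPreSteps (hF₁ : PreFrobenioid.IsFrobenioid C₁.toElem)
    (hF₂ : PreFrobenioid.IsFrobenioid C₂.toElem) (hps : h.PreservesPreSteps) :
    PreFrobenioid.IsFrobeniusCompatible C₂.toElem C₁.toElem h.Ψ.inverse :=
  FrdI.isFrobeniusCompatible_of_preservesPreSteps hF₂ hF₁ (C₂.data_isOfQuasiIsotropicType hF₂)
    (C₁.data_isOfQuasiIsotropicType hF₁) (C₂.data_isNonDilatingOn h.nonDilating.2)
    (C₁.data_isNonDilatingOn h.nonDilating.1) h.Ψ.symm hps.2 hps.1 C₂.exists_not_isGroupLikeObj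
    C₁.exists_not_isGroupLikeObj

/-- **C38-L03′ ⟸ C38-L02a** (modulo `hF₁`, `hF₂`), at the canonical monoid vocabulary. PROVED.
[cite: MochizukiEtTh2009, Cor 3.8 p.81] -/
theorem compatibleWithPerfectionR_of_preservesPreSteps (hF₁ : PreFrobenioid.IsFrobenioid C₁.toElem)
    (hF₂ : PreFrobenioid.IsFrobenioid C₂.toElem) (hps : h.PreservesPreSteps) :
    h.CompatibleWithPerfectionR hF₁ hF₂ :=
  h.compatibleWithPerfectionR_of_isFrobeniusCompatible hF₁ hF₂
    (h.isFrobeniusCompatible_of_preservesPreSteps hF₁ hF₂ hps)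

end Cor38Hyp

end TreeVocab

end Literature.AnabelianGeometry.EtaleTheta
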